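import Literature.Geometry.Kaehler.SiegelTorusThetaDivisorEtaModular
import Literature.Analysis.SpecialFunctions.RiemannThetaTransformationKappa
import HarnessLib

/-!
# De Jong's modular weight of `η`: on `ϑ = 0`, `η(ᵗ(γZ+δ)⁻¹v, M(Z))² = ζ^{2(n+1)} det(γZ+δ)^{n+5} q(v)^{2(n+1)} η(v,Z)²`
# with `|ζ| = 1`, and `|η(ᵗD⁻¹v, M(Z))| = |det(γZ+δ)|^{(n+5)/2} |q(v)|^{n+1} |η(v,Z)|`

[tag: lange-cav-complex-tori] [linked: HodgeConjecture (lit-hodgefound SKELETON §A2, row A2-215)]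

Layer `Literature/Geometry/Kaehler`, namespace `Literature.Geometry.Kaehler.ComplexTorus`; lane
`lit-hodgefound` (Track 2 foundations library), skeleton seat `lit-hodgefound-skel-2` (generation 43), plan
row A2-215 = pointer (75) of the gen-43 list — the modular WEIGHT in de Jong's Thm. 1.3. A2-210
(`SiegelTorusThetaDivisorEtaModular`) proved `η(ᵗD⁻¹v, M(Z)) = det(D)² · C^{n+1} q(v)^{n+1} · η(v,Z)` on
`ϑ[c](v,Z) = 0` with the (unnamed) constant `C ≠ 0` of the theta transformation formula; the tree's
`RiemannThetaTransformationKappa` (Lange Thm. 3.3.9, Steps II–III) proves `C² = u(M) e(2πi k(M,c)) det(D)`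
with `|u(M)| = 1`. Together: the weight `2 + (n+1)/2 = (n+5)/2` as printed, stated SQUARED (no square root
of `det(γZ+δ)` is chosen) and in absolute value. Theorems only; no definition, no named fact.

Sources, VERBATIM. R. de Jong, *Theta functions on the theta divisor*, Rocky Mountain J. Math. 40 (2010)
[held `paper:arxiv-math_0611810`], Thm. 1.3 (chunk p0002: "`η` is a theta function of weight `(g+5)/2`")
and §4, proof (chunk p0008): "`θ(ᵗ(cτ+d)⁻¹z, (aτ+b)(cτ+d)⁻¹) = ζ_γ det(cτ+d)^{1/2} q(z,γ,τ) θ(z,τ)` for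
all `z` […] and all `γ = (a b; c d)` in `Γ_{1,2}`, where `q(z,γ,τ) = e^{πi ᵗz(cτ+d)⁻¹cz}` and where `ζ_γ` is
an 8-th root of unity. We claim that `η(ᵗ(cτ+d)⁻¹z, (aτ+b)(cτ+d)⁻¹) = det(cτ+d)^{(n+5)/2} ζ_γ^{n+1}
q(z,γ,τ)^{n+1} η(z,τ)` for all `(z,τ)` satisfying `θ(z,τ)=0`. This is just a calculation." H. Lange,
*Abelian Varieties over the Complex Numbers* (2023), §3.3.3 Thm. 3.3.9, proof, Step II (p0177):
"`C(Z, M, 0)⁻¹` and `det(γZ+δ)^{1/2}` differ only by a constant […] `κ(M) ∈ ℂ₁`". S. Grushevsky,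
R. Salvati Manni, Proc. AMS 136 (2008), Definition 5 (the action and `M[ε;δ]`).

Dictionary. `F′ = ϑ[M[a;b]](·, M(Z))`, `F = ϑ[a;b](·, Z)`, `D = denom(M,Z) = γZ+δ`,
`q(v) = e(πi ᵗv D⁻¹γ v)` (`cexp (π I (v ⬝ᵥ (D⁻¹ γ) v))`, `γ = (M.map ↑).toBlocks₂₁`), `B_F(v)[e]` the bordered
Hessian in the standard coordinates, `η = det B`.

## Contents

* §1 **`exists_riemannThetaChar_transform_and_det_borderedHessian_eq`** — ONE constant `C ≠ 0` serving both
  the theta transformation law and A2-210's law `η′(ᵗD⁻¹v) = det(D)² (C q(v))^{n+1} η(v)` on `F(v) = 0`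
  (A2-210 re-run with the constant exposed).
* §2 **`sq_det_borderedHessian_riemannThetaChar_moeb_mulVec_eq`** — every characteristic: `η′(ᵗD⁻¹v)² =
  (u e(2πik))^{n+1} det(D)^{n+5} q(v)^{2(n+1)} η(v)²` with `|u| = 1` depending only on `M`;
  **`sq_det_borderedHessian_riemannTheta_moeb_mulVec_eq`** — `c = 0`: `η′² = u^{n+1} det(D)^{n+5} q^{2(n+1)} η²`.
* §3 **`norm_det_borderedHessian_riemannTheta_moeb_mulVec_eq`** — `|η′(ᵗD⁻¹v)| = (√|det D|)^{n+5} |q(v)|^{n+1}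
  |η(v)|`: the weight `(n+5)/2` in absolute value.

## References

* [DeJong2010ThetaFunctionsThetaDivisor] R. de Jong, Theta functions on the theta divisor, Rocky Mountain
  J. Math. 40 (2010), Thm. 1.3, §4.
* [Lange2023AbelianVarietiesComplex] H. Lange, Abelian Varieties over the Complex Numbers (2023), §3.3.3
  Thm. 3.3.9 (proof, Steps II–III).
* [GrushevskySalvatiManni2008] S. Grushevsky, R. Salvati Manni, Proc. AMS 136 (2008), Definition 5.
-/

noncomputable section

open scoped Matrix Topology Real
open Set Function Module Complex Matrix
open Literature.Analysis.SpecialFunctions Literature.Analysis.Complex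

namespace Literature.Geometry.Kaehler

namespace ComplexTorus

open Literature.NumberTheory.Automorphic (siegelUpperHalfSpace)
open Literature.NumberTheory.ModularForms.SiegelUpperHalfSpace (moeb denom)

section EtaWeight

variable {n : ℕ} {M : Matrix (Fin n ⊕ Fin n) (Fin n ⊕ Fin n) ℤ} {Z : Matrix (Fin n) (Fin n) ℂ}

/-- `v ↦ C · e(c ᵗv S v)` is entire. [folklore] -/
private theorem differentiable_const_mul_cexp_dotProduct_mulVec₄ (C c : ℂ) (S : Matrix (Fin n) (Fin n) ℂ) :
    Differentiable ℂ fun v : Fin n → ℂ => C * cexp (c * (v ⬝ᵥ (S *ᵥ v))) := by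
  have h : Differentiable ℂ fun v : Fin n → ℂ => v ⬝ᵥ (S *ᵥ v) := by
    simp only [dotProduct, mulVec]
    fun_prop
  exact ((h.const_mul c).cexp).const_mul C

/-- `ϑ[c](·, Z)` is entire for `Z ∈ 𝔥_g`. [cite: Lange2023AbelianVarietiesComplex, §3.3.3 Thm. 3.3.9] -/
private theorem differentiable_riemannThetaChar₄ (hZ : Z ∈ siegelUpperHalfSpace n) (a b : Fin n → ℂ) :
    Differentiable ℂ (riemannThetaChar a b Z) := by
  obtain ⟨c, hc, hY⟩ := exists_pos_mul_sum_sq_le_of_posDef_im Z hZ.2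
  exact differentiable_riemannThetaChar Z (fun i j => (hZ.1.apply i j).symm) hc hY a b

/-! ### §1 One constant for the theta law and the `η` law -/

/-- **One constant `C ≠ 0` serves both laws**: `ϑ[M[c]](ᵗD⁻¹v, M(Z)) = C q(v) ϑ[c](v,Z)` for all `v`, and
`η′(ᵗD⁻¹v) = det(D)² (C q(v))^{n+1} η(v)` at every `v` with `ϑ[c](v,Z) = 0` (A2-210's computation with the
constant exposed). [cite: DeJong2010ThetaFunctionsThetaDivisor, §4, proof of Thm. 1.3 (chunk p0008: "This is just a calculation")] [cite: GrushevskySalvatiManni2008, Definition 5 (p0004 of the held text)] -/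
theorem exists_riemannThetaChar_transform_and_det_borderedHessian_eq
    (hM : M ∈ Matrix.symplecticGroup (Fin n) ℤ) (hZ : Z ∈ siegelUpperHalfSpace n) (a b : Fin n → ℂ) :
    ∃ C : ℂ, C ≠ 0 ∧
      (∀ v : Fin n → ℂ,
        riemannThetaChar (thetaCharFst M a b) (thetaCharSnd M a b) (moeb (M.map ((↑) : ℤ → ℂ)) Z)
            ((denom (M.map ((↑) : ℤ → ℂ)) Z)ᵀ⁻¹ *ᵥ v) =
          C * cexp (π * I * (v ⬝ᵥ ((denom (M.map ((↑) : ℤ → ℂ)) Z)⁻¹ *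
            (M.map ((↑) : ℤ → ℂ)).toBlocks₂₁) *ᵥ v)) * riemannThetaChar a b Z v) ∧
      ∀ v : Fin n → ℂ, riemannThetaChar a b Z v = 0 →
        (Matrix.fromBlocks
            (Matrix.of fun i j : Fin n => fderiv ℂ (fderiv ℂ (riemannThetaChar (thetaCharFst M a b)
              (thetaCharSnd M a b) (moeb (M.map ((↑) : ℤ → ℂ)) Z)))
              ((denom (M.map ((↑) : ℤ → ℂ)) Z)ᵀ⁻¹ *ᵥ v) (Pi.single i (1 : ℂ)) (Pi.single j (1 : ℂ)))
            (Matrix.of fun (i : Fin n) (_ : Unit) => fderiv ℂ (riemannThetaChar (thetaCharFst M a b)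
              (thetaCharSnd M a b) (moeb (M.map ((↑) : ℤ → ℂ)) Z))
              ((denom (M.map ((↑) : ℤ → ℂ)) Z)ᵀ⁻¹ *ᵥ v) (Pi.single i (1 : ℂ)))
            (Matrix.of fun (_ : Unit) (j : Fin n) => fderiv ℂ (riemannThetaChar (thetaCharFst M a b)
              (thetaCharSnd M a b) (moeb (M.map ((↑) : ℤ → ℂ)) Z))
              ((denom (M.map ((↑) : ℤ → ℂ)) Z)ᵀ⁻¹ *ᵥ v) (Pi.single j (1 : ℂ)))
            (0 : Matrix Unit Unit ℂ)).det =
          (denom (M.map ((↑) : ℤ → ℂ)) Z).det ^ 2 *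
            (C * cexp (π * I * (v ⬝ᵥ ((denom (M.map ((↑) : ℤ → ℂ)) Z)⁻¹ *
              (M.map ((↑) : ℤ → ℂ)).toBlocks₂₁) *ᵥ v))) ^ (n + 1) *
            (Matrix.fromBlocks
              (Matrix.of fun i j : Fin n => fderiv ℂ (fderiv ℂ (riemannThetaChar a b Z)) v
                (Pi.single i (1 : ℂ)) (Pi.single j (1 : ℂ)))
              (Matrix.of fun (i : Fin n) (_ : Unit) => fderiv ℂ (riemannThetaChar a b Z) v (Pi.single i (1 : ℂ)))
              (Matrix.of fun (_ : Unit) (j : Fin n) => fderiv ℂ (riemannThetaChar a b Z) v (Pi.single j (1 : ℂ)))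
              (0 : Matrix Unit Unit ℂ)).det := by
  obtain ⟨C, hC, hCF⟩ := exists_riemannThetaChar_transform hM hZ a b
  have hFd : Differentiable ℂ (riemannThetaChar (thetaCharFst M a b) (thetaCharSnd M a b)
      (moeb (M.map ((↑) : ℤ → ℂ)) Z)) :=
    differentiable_riemannThetaChar₄ (moeb_intCast_mem hM hZ) _ _
  have hGd := differentiable_riemannThetaChar₄ hZ a b
  have hed := differentiable_const_mul_cexp_dotProduct_mulVec₄ C (π * I)
    ((denom (M.map ((↑) : ℤ → ℂ)) Z)⁻¹ * (M.map ((↑) : ℤ → ℂ)).toBlocks₂₁)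
  have hDu : IsUnit (denom (M.map ((↑) : ℤ → ℂ)) Z).det := isUnit_det_denom_intCast hM hZ
  refine ⟨C, hC, hCF, fun v hv => ?_⟩
  have key := SCV.det_borderedHessian_mulVec_eq_of_comp_mulVec hFd hGd hed _ hCF hv
  set X := (Matrix.fromBlocks
          (Matrix.of fun i j : Fin n => fderiv ℂ (fderiv ℂ (riemannThetaChar (thetaCharFst M a b)
            (thetaCharSnd M a b) (moeb (M.map ((↑) : ℤ → ℂ)) Z)))
            ((denom (M.map ((↑) : ℤ → ℂ)) Z)ᵀ⁻¹ *ᵥ v) (Pi.single i (1 : ℂ)) (Pi.single j (1 : ℂ)))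
          (Matrix.of fun (i : Fin n) (_ : Unit) => fderiv ℂ (riemannThetaChar (thetaCharFst M a b)
            (thetaCharSnd M a b) (moeb (M.map ((↑) : ℤ → ℂ)) Z))
            ((denom (M.map ((↑) : ℤ → ℂ)) Z)ᵀ⁻¹ *ᵥ v) (Pi.single i (1 : ℂ)))
          (Matrix.of fun (_ : Unit) (j : Fin n) => fderiv ℂ (riemannThetaChar (thetaCharFst M a b)
            (thetaCharSnd M a b) (moeb (M.map ((↑) : ℤ → ℂ)) Z))
            ((denom (M.map ((↑) : ℤ → ℂ)) Z)ᵀ⁻¹ *ᵥ v) (Pi.single j (1 : ℂ)))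
          (0 : Matrix Unit Unit ℂ)).det with hX
  have hd : ((denom (M.map ((↑) : ℤ → ℂ)) Z)ᵀ⁻¹).det * (denom (M.map ((↑) : ℤ → ℂ)) Z).det = 1 := by
    have h := Matrix.det_nonsing_inv_mul_det _ (Matrix.isUnit_det_transpose _ hDu)
    rwa [Matrix.det_transpose] at h
  calc X = (((denom (M.map ((↑) : ℤ → ℂ)) Z)ᵀ⁻¹).det * (denom (M.map ((↑) : ℤ → ℂ)) Z).det) ^ 2 * X := by
        rw [hd, one_pow, one_mul]
    _ = (denom (M.map ((↑) : ℤ → ℂ)) Z).det ^ 2 * (((denom (M.map ((↑) : ℤ → ℂ)) Z)ᵀ⁻¹).det ^ 2 * X) := by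
        ring
    _ = _ := by rw [key]; ring

/-! ### §2 The weight `(n+5)/2`, squared -/

/-- **DE JONG'S THM. 1.3, MODULAR HALF, SQUARED (every characteristic)**: there is `u = u(M)` with `|u| = 1`
such that for all `Z ∈ 𝔥_g`, all characteristics `c = (a,b)` and every `v` with `ϑ[c](v,Z) = 0`,
`η′(ᵗD⁻¹v)² = (u · e(2πi k(M,c)))^{n+1} · det(γZ+δ)^{n+5} · q(v)^{2(n+1)} · η(v)²` — "`η(ᵗ(cτ+d)⁻¹z, γ·τ) =
det(cτ+d)^{(n+5)/2} ζ_γ^{n+1} q(z,γ,τ)^{n+1} η(z,τ)`" squared, with Lange's `C² = u e(2πik) det(γZ+δ)`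
(`exists_unit_sq_riemannThetaChar_transform_const_char`) in place of a choice of `det^{1/2}`.
[cite: DeJong2010ThetaFunctionsThetaDivisor, Thm. 1.3 and §4, proof (chunk p0008)] [cite: Lange2023AbelianVarietiesComplex, §3.3.3 Thm. 3.3.9, proof, Steps II–III (p0177: "`κ(M) ∈ ℂ₁`")] -/
theorem sq_det_borderedHessian_riemannThetaChar_moeb_mulVec_eq (hM : M ∈ Matrix.symplecticGroup (Fin n) ℤ) :
    ∃ u : ℂ, ‖u‖ = 1 ∧ ∀ (Z : Matrix (Fin n) (Fin n) ℂ), Z ∈ siegelUpperHalfSpace n →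
      ∀ (a b : Fin n → ℂ) (v : Fin n → ℂ), riemannThetaChar a b Z v = 0 →
        (Matrix.fromBlocks
            (Matrix.of fun i j : Fin n => fderiv ℂ (fderiv ℂ (riemannThetaChar (thetaCharFst M a b)
              (thetaCharSnd M a b) (moeb (M.map ((↑) : ℤ → ℂ)) Z)))
              ((denom (M.map ((↑) : ℤ → ℂ)) Z)ᵀ⁻¹ *ᵥ v) (Pi.single i (1 : ℂ)) (Pi.single j (1 : ℂ)))
            (Matrix.of fun (i : Fin n) (_ : Unit) => fderiv ℂ (riemannThetaChar (thetaCharFst M a b)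
              (thetaCharSnd M a b) (moeb (M.map ((↑) : ℤ → ℂ)) Z))
              ((denom (M.map ((↑) : ℤ → ℂ)) Z)ᵀ⁻¹ *ᵥ v) (Pi.single i (1 : ℂ)))
            (Matrix.of fun (_ : Unit) (j : Fin n) => fderiv ℂ (riemannThetaChar (thetaCharFst M a b)
              (thetaCharSnd M a b) (moeb (M.map ((↑) : ℤ → ℂ)) Z))
              ((denom (M.map ((↑) : ℤ → ℂ)) Z)ᵀ⁻¹ *ᵥ v) (Pi.single j (1 : ℂ)))
            (0 : Matrix Unit Unit ℂ)).det ^ 2 =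
          (u * cexp (2 * π * I * thetaTransformPhase M a b)) ^ (n + 1) *
            (denom (M.map ((↑) : ℤ → ℂ)) Z).det ^ (n + 5) *
            cexp (π * I * (v ⬝ᵥ ((denom (M.map ((↑) : ℤ → ℂ)) Z)⁻¹ *
              (M.map ((↑) : ℤ → ℂ)).toBlocks₂₁) *ᵥ v)) ^ (2 * (n + 1)) *
            (Matrix.fromBlocks
              (Matrix.of fun i j : Fin n => fderiv ℂ (fderiv ℂ (riemannThetaChar a b Z)) v
                (Pi.single i (1 : ℂ)) (Pi.single j (1 : ℂ)))
              (Matrix.of fun (i : Fin n) (_ : Unit) => fderiv ℂ (riemannThetaChar a b Z) v (Pi.single i (1 : ℂ)))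
              (Matrix.of fun (_ : Unit) (j : Fin n) => fderiv ℂ (riemannThetaChar a b Z) v (Pi.single j (1 : ℂ)))
              (0 : Matrix Unit Unit ℂ)).det ^ 2 := by
  obtain ⟨u, hu, hsq⟩ := exists_unit_sq_riemannThetaChar_transform_const_char hM
  refine ⟨u, hu, fun Z hZ a b v hv => ?_⟩
  obtain ⟨C, -, hCF, hdet⟩ := exists_riemannThetaChar_transform_and_det_borderedHessian_eq hM hZ a b
  have hC2 := hsq Z hZ a b C hCF
  rw [hdet v hv]
  generalize (Matrix.fromBlocks
      (Matrix.of fun i j : Fin n => fderiv ℂ (fderiv ℂ (riemannThetaChar a b Z)) v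
        (Pi.single i (1 : ℂ)) (Pi.single j (1 : ℂ)))
      (Matrix.of fun (i : Fin n) (_ : Unit) => fderiv ℂ (riemannThetaChar a b Z) v (Pi.single i (1 : ℂ)))
      (Matrix.of fun (_ : Unit) (j : Fin n) => fderiv ℂ (riemannThetaChar a b Z) v (Pi.single j (1 : ℂ)))
      (0 : Matrix Unit Unit ℂ)).det = η
  generalize cexp (π * I * (v ⬝ᵥ ((denom (M.map ((↑) : ℤ → ℂ)) Z)⁻¹ *
    (M.map ((↑) : ℤ → ℂ)).toBlocks₂₁) *ᵥ v)) = q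
  generalize hd : (denom (M.map ((↑) : ℤ → ℂ)) Z).det = d
  rw [hd] at hC2
  rw [show (d ^ 2 * (C * q) ^ (n + 1) * η) ^ 2 = (C ^ 2) ^ (n + 1) * d ^ 4 * q ^ (2 * (n + 1)) * η ^ 2 by ring,
    hC2]
  ring

/-- **The same for `ϑ = ϑ[0;0]`**: `η′(ᵗD⁻¹v)² = u^{n+1} det(γZ+δ)^{n+5} q(v)^{2(n+1)} η(v)²` on `ϑ(v,Z) = 0`,
`|u| = 1` depending only on `M` — the multiplier `ζ_γ^{2(n+1)}` and the weight `(n+5)/2`, squared.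
[cite: DeJong2010ThetaFunctionsThetaDivisor, Thm. 1.3 (chunk p0002) and §4, proof (chunk p0008)] [cite: Lange2023AbelianVarietiesComplex, §3.3.3 Thm. 3.3.9, proof, Step II (p0177)] -/
theorem sq_det_borderedHessian_riemannTheta_moeb_mulVec_eq (hM : M ∈ Matrix.symplecticGroup (Fin n) ℤ) :
    ∃ u : ℂ, ‖u‖ = 1 ∧ ∀ (Z : Matrix (Fin n) (Fin n) ℂ), Z ∈ siegelUpperHalfSpace n →
      ∀ v : Fin n → ℂ, riemannThetaChar 0 0 Z v = 0 →
        (Matrix.fromBlocks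
            (Matrix.of fun i j : Fin n => fderiv ℂ (fderiv ℂ (riemannThetaChar (thetaCharFst M 0 0)
              (thetaCharSnd M 0 0) (moeb (M.map ((↑) : ℤ → ℂ)) Z)))
              ((denom (M.map ((↑) : ℤ → ℂ)) Z)ᵀ⁻¹ *ᵥ v) (Pi.single i (1 : ℂ)) (Pi.single j (1 : ℂ)))
            (Matrix.of fun (i : Fin n) (_ : Unit) => fderiv ℂ (riemannThetaChar (thetaCharFst M 0 0)
              (thetaCharSnd M 0 0) (moeb (M.map ((↑) : ℤ → ℂ)) Z))
              ((denom (M.map ((↑) : ℤ → ℂ)) Z)ᵀ⁻¹ *ᵥ v) (Pi.single i (1 : ℂ)))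
            (Matrix.of fun (_ : Unit) (j : Fin n) => fderiv ℂ (riemannThetaChar (thetaCharFst M 0 0)
              (thetaCharSnd M 0 0) (moeb (M.map ((↑) : ℤ → ℂ)) Z))
              ((denom (M.map ((↑) : ℤ → ℂ)) Z)ᵀ⁻¹ *ᵥ v) (Pi.single j (1 : ℂ)))
            (0 : Matrix Unit Unit ℂ)).det ^ 2 =
          u ^ (n + 1) * (denom (M.map ((↑) : ℤ → ℂ)) Z).det ^ (n + 5) *
            cexp (π * I * (v ⬝ᵥ ((denom (M.map ((↑) : ℤ → ℂ)) Z)⁻¹ *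
              (M.map ((↑) : ℤ → ℂ)).toBlocks₂₁) *ᵥ v)) ^ (2 * (n + 1)) *
            (Matrix.fromBlocks
              (Matrix.of fun i j : Fin n => fderiv ℂ (fderiv ℂ (riemannThetaChar 0 0 Z)) v
                (Pi.single i (1 : ℂ)) (Pi.single j (1 : ℂ)))
              (Matrix.of fun (i : Fin n) (_ : Unit) => fderiv ℂ (riemannThetaChar 0 0 Z) v (Pi.single i (1 : ℂ)))
              (Matrix.of fun (_ : Unit) (j : Fin n) => fderiv ℂ (riemannThetaChar 0 0 Z) v (Pi.single j (1 : ℂ)))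
              (0 : Matrix Unit Unit ℂ)).det ^ 2 := by
  obtain ⟨u, hu, hsq⟩ := exists_unit_sq_riemannThetaChar_transform_const_eq_mul_det_denom hM
  refine ⟨u, hu, fun Z hZ v hv => ?_⟩
  obtain ⟨C, -, hCF, hdet⟩ := exists_riemannThetaChar_transform_and_det_borderedHessian_eq hM hZ 0 0
  have hC2 := hsq Z hZ C hCF
  rw [hdet v hv]
  generalize (Matrix.fromBlocks
      (Matrix.of fun i j : Fin n => fderiv ℂ (fderiv ℂ (riemannThetaChar 0 0 Z)) v
        (Pi.single i (1 : ℂ)) (Pi.single j (1 : ℂ)))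
      (Matrix.of fun (i : Fin n) (_ : Unit) => fderiv ℂ (riemannThetaChar 0 0 Z) v (Pi.single i (1 : ℂ)))
      (Matrix.of fun (_ : Unit) (j : Fin n) => fderiv ℂ (riemannThetaChar 0 0 Z) v (Pi.single j (1 : ℂ)))
      (0 : Matrix Unit Unit ℂ)).det = η
  generalize cexp (π * I * (v ⬝ᵥ ((denom (M.map ((↑) : ℤ → ℂ)) Z)⁻¹ *
    (M.map ((↑) : ℤ → ℂ)).toBlocks₂₁) *ᵥ v)) = q
  generalize hd : (denom (M.map ((↑) : ℤ → ℂ)) Z).det = d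
  rw [hd] at hC2
  rw [show (d ^ 2 * (C * q) ^ (n + 1) * η) ^ 2 = (C ^ 2) ^ (n + 1) * d ^ 4 * q ^ (2 * (n + 1)) * η ^ 2 by ring,
    hC2]
  ring

/-! ### §3 The weight `(n+5)/2` in absolute value -/

/-- **`|η(ᵗ(γZ+δ)⁻¹v, M(Z))| = (√|det(γZ+δ)|)^{n+5} · |q(v)|^{n+1} · |η(v,Z)|` on `ϑ(v,Z) = 0`** — the modular
weight `(n+5)/2` of de Jong's `η` in absolute value (`|C| = √|det(γZ+δ)|`, `|u| = 1`).
[cite: DeJong2010ThetaFunctionsThetaDivisor, Thm. 1.3 (chunk p0002: "a theta function of weight `(g+5)/2`") and §4 (chunk p0008)] [cite: Lange2023AbelianVarietiesComplex, §3.3.3 Thm. 3.3.9, proof, Step II (p0175–p0177: "`|C(Z, M, 0)|⁻² = |det(γZ + δ)|`")] -/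
theorem norm_det_borderedHessian_riemannTheta_moeb_mulVec_eq (hM : M ∈ Matrix.symplecticGroup (Fin n) ℤ)
    (hZ : Z ∈ siegelUpperHalfSpace n) {v : Fin n → ℂ} (hv : riemannThetaChar 0 0 Z v = 0) :
    ‖(Matrix.fromBlocks
        (Matrix.of fun i j : Fin n => fderiv ℂ (fderiv ℂ (riemannThetaChar (thetaCharFst M 0 0)
          (thetaCharSnd M 0 0) (moeb (M.map ((↑) : ℤ → ℂ)) Z)))
          ((denom (M.map ((↑) : ℤ → ℂ)) Z)ᵀ⁻¹ *ᵥ v) (Pi.single i (1 : ℂ)) (Pi.single j (1 : ℂ)))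
        (Matrix.of fun (i : Fin n) (_ : Unit) => fderiv ℂ (riemannThetaChar (thetaCharFst M 0 0)
          (thetaCharSnd M 0 0) (moeb (M.map ((↑) : ℤ → ℂ)) Z))
          ((denom (M.map ((↑) : ℤ → ℂ)) Z)ᵀ⁻¹ *ᵥ v) (Pi.single i (1 : ℂ)))
        (Matrix.of fun (_ : Unit) (j : Fin n) => fderiv ℂ (riemannThetaChar (thetaCharFst M 0 0)
          (thetaCharSnd M 0 0) (moeb (M.map ((↑) : ℤ → ℂ)) Z))
          ((denom (M.map ((↑) : ℤ → ℂ)) Z)ᵀ⁻¹ *ᵥ v) (Pi.single j (1 : ℂ)))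
        (0 : Matrix Unit Unit ℂ)).det‖ =
      Real.sqrt ‖(denom (M.map ((↑) : ℤ → ℂ)) Z).det‖ ^ (n + 5) *
        ‖cexp (π * I * (v ⬝ᵥ ((denom (M.map ((↑) : ℤ → ℂ)) Z)⁻¹ *
          (M.map ((↑) : ℤ → ℂ)).toBlocks₂₁) *ᵥ v))‖ ^ (n + 1) *
        ‖(Matrix.fromBlocks
          (Matrix.of fun i j : Fin n => fderiv ℂ (fderiv ℂ (riemannThetaChar 0 0 Z)) v
            (Pi.single i (1 : ℂ)) (Pi.single j (1 : ℂ)))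
          (Matrix.of fun (i : Fin n) (_ : Unit) => fderiv ℂ (riemannThetaChar 0 0 Z) v (Pi.single i (1 : ℂ)))
          (Matrix.of fun (_ : Unit) (j : Fin n) => fderiv ℂ (riemannThetaChar 0 0 Z) v (Pi.single j (1 : ℂ)))
          (0 : Matrix Unit Unit ℂ)).det‖ := by
  obtain ⟨u, hu, hsq⟩ := exists_unit_sq_riemannThetaChar_transform_const_eq_mul_det_denom hM
  obtain ⟨C, -, hCF, hdet⟩ := exists_riemannThetaChar_transform_and_det_borderedHessian_eq hM hZ 0 0
  have hC2 := hsq Z hZ C hCF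
  -- `|C|² = |det D|`, so `|C| = √|det D|`
  have hCn : ‖C‖ = Real.sqrt ‖(denom (M.map ((↑) : ℤ → ℂ)) Z).det‖ := by
    have h1 : ‖C‖ ^ 2 = ‖(denom (M.map ((↑) : ℤ → ℂ)) Z).det‖ := by
      rw [← norm_pow, hC2, norm_mul, hu, one_mul]
    rw [← h1, Real.sqrt_sq (norm_nonneg C)]
  rw [hdet v hv]
  simp only [norm_mul, norm_pow]
  rw [hCn]
  have hs : ‖(denom (M.map ((↑) : ℤ → ℂ)) Z).det‖ = Real.sqrt ‖(denom (M.map ((↑) : ℤ → ℂ)) Z).det‖ ^ 2 :=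
    (Real.sq_sqrt (norm_nonneg _)).symm
  generalize hσ : Real.sqrt ‖(denom (M.map ((↑) : ℤ → ℂ)) Z).det‖ = σ at hs ⊢
  rw [hs]
  ring

end EtaWeight

end ComplexTorus

end Literature.Geometry.Kaehler
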